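import Summits.Schanuel.Schanuel.Theorems.ZilberEacComplexHypersurfaceEscape
import HarnessLib

/-!
# EC by linear escape over an arbitrary hypersurface base: a model on the complex sphere

Companion to `ZilberEacComplexHypersurfaceEscape.lean` (Theorem H_esc: Exponential-Algebraic Closedness
over ANY hypersurface base `{H = 0} ⊆ ℂⁿ` for Laurent-parametrised fibres `yᵢ = cᵢt^{νᵢ} + …`, under a
simple root `λ`, `Re λ > 0`, of the lattice polynomial `H_D(λν + 2πiq)`; first open rung
`dim π₁(V) = n - 1`, Mantova–Masser, PLMS 129 (2024), §1 p. 5). Here the hypothesis is checked by hand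
for the COMPLEX SPHERE `x₁² + x₂² + x₃² = 1` with the diagonal escape `ν = (1,1,1)`, `q = (1,0,0)`:
`H₂(λν + 2πiq) = 3λ² + 4πiλ - 4π²` has the simple root `λ = 2π(√2 - i)/3`, `Re λ = 2π√2/3 > 0`.

* `sphere_diagonalEscape_model_system_solvable` — there are `z ∈ ℂ³` on the sphere `Σ zᵢ² = 1` and
  `L` with `e^{zᵢ} = e^{L} + zᵢ` (`i = 1,2,3`): the 3-fold `{Σxᵢ² = 1, y₁ - x₁ = y₂ - x₂ = y₃ - x₃}`
  (`dim π₁ V = 2`, base a sphere — not a graph, not covered by the packet's cyclic-cover theorems,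
  whose fibres are of puncture type) meets the graph of `exp`;
* `sphereDiagonal_inter_expGraph_nonempty` — the same in the vocabulary of
  `Literature.NumberTheory.Transcendental.expGraph`.

HONEST FRAMING: explicit members of the open cell EC(3,2); modest sub-rung of EAC; nothing here bears
on Schanuel's conjecture, and EC(3,2) itself stays open.
-/

noncomputable section

open Complex MvPolynomial Metric Set Filter Topology

set_option linter.dupNamespace false

namespace Summit.Schanuel.Schanuel.Theorems

/-- **Exponential points with diagonal escape on the complex sphere**: there are `z ∈ ℂ³` with
`z₁² + z₂² + z₃² = 1` and `L ∈ ℂ` with `e^{zᵢ} = e^{L} + zᵢ` for `i = 1, 2, 3`; equivalently the 3-fold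
`V = {Σ xᵢ² = 1, y₁ - x₁ = y₂ - x₂ = y₃ - x₃} ⊆ ℂ³ × ℂˣ³` (additive projection the sphere, `dim π₁ V = 2`:
the open case of Mantova–Masser 2024 §1 p. 5) meets the graph of `exp`. Theorem H_esc with
`H = Σxᵢ² - 1`, `ν = (1,1,1)`, `q = (1,0,0)`, `λ = 2π(√2 - i)/3` (a simple root of
`3λ² + 4πiλ - 4π² = H₂(λν + 2πiq)`, `Σᵢ νᵢ∂ᵢH₂(v) = 4π√2 ≠ 0`), `cᵢ = 1`, `A_{i,0} = xᵢ`. New.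
[cite: MantovaMasser2023, §1 p.5 (the open case dim π(V) = 2 in ℂ³×ℂˣ³)] -/
theorem sphere_diagonalEscape_model_system_solvable :
    ∃ z : Fin 3 → ℂ, ∃ L : ℂ, z 0 ^ 2 + z 1 ^ 2 + z 2 ^ 2 = 1 ∧ ∀ i, exp (z i) = exp L + z i := by
  -- the sphere and its leading form
  set Q : MvPolynomial (Fin 3) ℂ := X 0 ^ 2 + X 1 ^ 2 + X 2 ^ 2 with hQ
  set H : MvPolynomial (Fin 3) ℂ := Q + C (-1) with hH
  have hQhom : Q.IsHomogeneous 2 :=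
    ((isHomogeneous_X_pow 0 2).add (isHomogeneous_X_pow 1 2)).add (isHomogeneous_X_pow 2 2)
  have hevalQ : ∀ x : Fin 3 → ℂ, eval x Q = x 0 ^ 2 + x 1 ^ 2 + x 2 ^ 2 := fun x => by
    simp [hQ, map_add, map_pow, eval_X]
  have hevalH : ∀ x : Fin 3 → ℂ, eval x H = x 0 ^ 2 + x 1 ^ 2 + x 2 ^ 2 - 1 := fun x => by
    rw [hH, map_add, hevalQ, eval_C]; ring
  have hQ0 : Q ≠ 0 := by
    intro h
    have := hevalQ fun _ => 1
    rw [h, map_zero] at this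
    norm_num at this
  have hQdeg : Q.totalDegree = 2 := hQhom.totalDegree hQ0
  have hHdeg : H.totalDegree = 2 := by
    rw [hH, totalDegree_add_eq_left_of_totalDegree_lt, hQdeg]
    rw [totalDegree_C, hQdeg]; norm_num
  have hHD : homogeneousComponent H.totalDegree H = Q := by
    rw [hHdeg, hH, map_add, homogeneousComponent_eq_self hQhom,
      homogeneousComponent_of_mem (isHomogeneous_C (Fin 3) (-1 : ℂ))]
    simp
  -- the partial derivatives of the leading form
  have hpd : ∀ i : Fin 3, ∀ x : Fin 3 → ℂ, eval x (pderiv i Q) = 2 * x i := by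
    intro i x
    have key : ∀ j : Fin 3, eval x (pderiv i (X j ^ 2 : MvPolynomial (Fin 3) ℂ)) =
        if j = i then 2 * x i else 0 := by
      intro j
      rw [pderiv_pow, pderiv_X]
      by_cases hji : j = i
      · subst hji; simp
      · simp [hji]
    rw [hQ, map_add, map_add, map_add, map_add, key, key, key]
    fin_cases i <;> simp
  -- the root `λ = 2π(√2 - i)/3` of `3λ² + 4πiλ - 4π²`
  set s2 : ℂ := (Real.sqrt 2 : ℂ) with hs2
  have hs2sq : s2 * s2 = 2 := by
    rw [hs2, ← Complex.ofReal_mul, Real.mul_self_sqrt (by norm_num : (0 : ℝ) ≤ 2)]; norm_num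
  have hs2ne : s2 ≠ 0 := by
    intro h; rw [h, mul_zero] at hs2sq; norm_num at hs2sq
  set lam : ℂ := 2 * Real.pi * (s2 - I) / 3 with hlam
  have hre : 0 < lam.re := by
    have : lam.re = 2 * Real.pi * Real.sqrt 2 / 3 := by
      simp [hlam, hs2]
    rw [this]; positivity
  set ν : Fin 3 → ℤ := fun _ => 1 with hν
  set q : Fin 3 → ℤ := ![1, 0, 0] with hq
  have hv : (fun i => lam * (ν i : ℂ) + 2 * Real.pi * I * (q i : ℂ)) =
      ![lam + 2 * Real.pi * I, lam, lam] := by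
    funext i; fin_cases i <;> simp [hν, hq]
  have hroot : eval (fun i => lam * (ν i : ℂ) + 2 * Real.pi * I * (q i : ℂ))
      (homogeneousComponent H.totalDegree H) = 0 := by
    rw [hHD, hv, hevalQ]
    simp only [Matrix.cons_val_zero, Matrix.cons_val_one, Matrix.head_cons, Matrix.cons_val_two,
      Matrix.tail_cons, hlam]
    linear_combination (4 * (Real.pi : ℂ) ^ 2 / 3) * hs2sq + (8 * (Real.pi : ℂ) ^ 2 / 3) * I_mul_I
  have hβ : ∑ i, (ν i : ℂ) * eval (fun i => lam * (ν i : ℂ) + 2 * Real.pi * I * (q i : ℂ))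
      (pderiv i (homogeneousComponent H.totalDegree H)) ≠ 0 := by
    rw [hHD, hv]
    simp only [hν, Int.cast_one, one_mul, hpd, Fin.sum_univ_three, Matrix.cons_val_zero,
      Matrix.cons_val_one, Matrix.head_cons, Matrix.cons_val_two, Matrix.tail_cons]
    have : 2 * (lam + 2 * Real.pi * I) + 2 * lam + 2 * lam = 4 * Real.pi * s2 := by
      rw [hlam]; ring
    rw [this]
    have hπ : (Real.pi : ℂ) ≠ 0 := by exact_mod_cast Real.pi_pos.ne'
    exact mul_ne_zero (mul_ne_zero (by norm_num) hπ) hs2ne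
  -- apply Theorem H_esc with `cᵢ = 1`, `Sᵢ = {0}`, `A_{i,0} = xᵢ`
  obtain ⟨x, L, hxH, hx⟩ := exists_expPoint_hypersurfaceEscape H (by rw [hHdeg]; norm_num) ν q lam
    hre hroot hβ (fun _ => 1) (fun _ => one_ne_zero) (fun _ => {0})
    (fun i m hm => by rw [Finset.mem_singleton] at hm; simp [hν, hm]) (fun i _ => X i)
  refine ⟨x, L, ?_, fun i => ?_⟩
  · have := hevalH x; rw [hxH] at this; linear_combination -this
  · have h := hx i
    simp only [hν, Int.cast_one, one_mul, Finset.sum_singleton, eval_X, Int.cast_zero, zero_mul,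
      Complex.exp_zero, mul_one] at h
    exact h

/-- **The sphere-diagonal 3-fold meets the graph of exponentiation** (EC vocabulary): the subvariety
`V = {x₁² + x₂² + x₃² = 1, y₁ - x₁ = y₂ - x₂, y₂ - x₂ = y₃ - x₃}` of `ℂ³ × ℂ³` (the Zariski closure of the
diagonal-escape family over the sphere; `dim V = 3`, `dim π₁ V = 2`) contains a point of
`Literature.NumberTheory.Transcendental.expGraph ℂ 3`. [cite: MantovaMasser2023, §1 p.5 (the open
case dim π(V) = 2 in ℂ³×ℂˣ³)] -/
theorem sphereDiagonal_inter_expGraph_nonempty :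
    ({z : Fin 3 ⊕ Fin 3 → ℂ |
        z (Sum.inl 0) ^ 2 + z (Sum.inl 1) ^ 2 + z (Sum.inl 2) ^ 2 = 1 ∧
        z (Sum.inr 0) - z (Sum.inl 0) = z (Sum.inr 1) - z (Sum.inl 1) ∧
        z (Sum.inr 1) - z (Sum.inl 1) = z (Sum.inr 2) - z (Sum.inl 2)} ∩
      Literature.NumberTheory.Transcendental.expGraph ℂ 3).Nonempty := by
  obtain ⟨x, L, hsph, hx⟩ := sphere_diagonalEscape_model_system_solvable
  refine ⟨Sum.elim x fun i => exp (x i), ⟨?_, ?_, ?_⟩, fun i => ?_⟩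
  · simpa using hsph
  · simp only [Sum.elim_inr, Sum.elim_inl, hx 0, hx 1]; ring
  · simp only [Sum.elim_inr, Sum.elim_inl, hx 1, hx 2]; ring
  · simp [Literature.ModelTheory.ExponentialFields.ExponentialRing.complex_exp_eq]

end Summit.Schanuel.Schanuel.Theorems
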